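import Mathlib
import Summits.Ventures.PercRepro2.UniversalSeriesStep

/-! # The series step of (UH*), fibre-wise — the precise form with slot re-labelling
(seat mine-b, cell pub-perc-repro2; MINE-B.md §25.2, §25.6)

`universal_ser_of_maps` (UniversalSeriesStep.lean) sends the slot `i` of a source `(x, z)` with
`r x = 0` to `(f (x, i), σ z)`.  The bundle instance of MINE-B.md §25.2 needs two refinements:

* a **slot re-labelling** `π`: the slot `i` of `(x, z)` goes to `(f (x, π (x, z, i)), σ z)`, where
  `π` is injective on the slots of each source and bounded by `b x` (the re-route of the «bad»
  sources, `(x, {K−1})` ↦ `(f (x, 1), ∅)`, is the case `π = 1`); the injectivity of `f` then decodes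
  `x` and `π`, and `π` decodes the slot;
* the **precise avoidance** hypothesis on the residual assignment `ψ`: `ψ p` differs from every
  actual image `(f (x, π …), σ z)` of the first family and from every actual image `(θ x, g (z, i))`
  of the second — not from the whole of `Im f × Im σ`, which the residual targets of the bundle
  instance do meet.

`universal_ser_of_maps_pi` is that theorem; the proof is the one of `universal_ser_of_maps` with
the two refinements threaded through. -/

namespace Summit.Ventures.PercRepro2.UHClosure

open Finset
open Summit.Ventures.PercRepro2.V2Closure (serR serB)

variable {X Y : Type*} [Preorder X] [Preorder Y] [Fintype X] [Fintype Y]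

section maps

variable (r b : X → ℕ) (r' b' : Y → ℕ)

/-- the `j`-th slot of the first coordinate of a product slot of the first kind -/
def serSlotXAt (q : SlotL (USrc (serR r r') (serB b b')) (serB b b')) (hx : r q.1.1.1.1 = 0)
    (j : ℕ) (hj : j < b q.1.1.1.1) : SlotL (USrc r b) b :=
  ⟨⟨⟨q.1.1.1.1, ⟨hx, (ser_src_blue r b r' b' q.1.1.2.1).1⟩, (ser_src_blue r b r' b' q.1.1.2.1).1⟩,
    ⟨j, by have h2 := lt_boundL b q.1.1.1.1; omega⟩⟩, hj⟩

omit [Preorder X] [Preorder Y] in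
/-- the source of the re-labelled `X`-slot -/
@[simp] lemma serSlotXAt_src (q : SlotL (USrc (serR r r') (serB b b')) (serB b b')) (hx : r q.1.1.1.1 = 0)
    (j : ℕ) (hj : j < b q.1.1.1.1) : (serSlotXAt r b r' b' q hx j hj).1.1.1 = q.1.1.1.1 := rfl

omit [Preorder X] [Preorder Y] in
/-- the index of the re-labelled `X`-slot -/
@[simp] lemma serSlotXAt_idx (q : SlotL (USrc (serR r r') (serB b b')) (serB b b')) (hx : r q.1.1.1.1 = 0)
    (j : ℕ) (hj : j < b q.1.1.1.1) : (serSlotXAt r b r' b' q hx j hj).1.2.val = j := rfl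

/-- the fibre-wise series assignment with the slot re-labelling `π` on the first family -/
noncomputable def serAssignPi (f : SlotL (USrc r b) b → X) (g : SlotL (USrc r' b') b' → Y)
    (σ : Y → Y) (θ : X → X) (ψ : X × Y → X × Y)
    (π : SlotL (USrc (serR r r') (serB b b')) (serB b b') → ℕ)
    (hπ : ∀ q, r q.1.1.1.1 = 0 → π q < b q.1.1.1.1)
    (q : SlotL (USrc (serR r r') (serB b b')) (serB b b')) : X × Y :=
  if hx : r q.1.1.1.1 = 0 then (f (serSlotXAt r b r' b' q hx (π q) (hπ q hx)), σ q.1.1.1.2)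
  else if hb : 2 ≤ b q.1.1.1.1 then
    (θ q.1.1.1.1, g (serSlotY r b r' b' q (by
      rcases ser_src_red r b r' b' q.1.1.2.1 with h | h
      · exact absurd h hx
      · exact h)))
  else ψ q.1.1.1

end maps

/-- **THE SERIES STEP OF (UH*), MODULO THE RESIDUAL FAMILY — precise form.**  As
`universal_ser_of_maps`, with the first family re-labelled by `π` (injective on the slots of each
source, below `b x`) and the residual `ψ` required to avoid exactly the images of the two
constructed families. -/
theorem universal_ser_of_maps_pi (r b : X → ℕ) (r' b' : Y → ℕ)
    (f : SlotL (USrc r b) b → X) (hf : Function.Injective f)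
    (hfs : ∀ p, f p ≤ p.1.1.1 ∧ r (f p) = 1 ∧ b p.1.1.1 ≤ b (f p) + 1)
    (g : SlotL (USrc r' b') b' → Y) (hg : Function.Injective g)
    (hgs : ∀ p, g p ≤ p.1.1.1 ∧ r' (g p) = 1 ∧ b' p.1.1.1 ≤ b' (g p) + 1)
    (σ : Y → Y) (hσ : ∀ z z', 1 ≤ b' z → 1 ≤ b' z' → σ z = σ z' → z = z')
    (hσs : ∀ z, 1 ≤ b' z → σ z ≤ z ∧ 1 ≤ r' (σ z) ∧ b' z ≤ b' (σ z) + 1)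
    (θ : X → X) (hθ : ∀ x x', 1 ≤ r x → 2 ≤ b x → 1 ≤ r x' → 2 ≤ b x' → θ x = θ x' → x = x')
    (hθs : ∀ x, 1 ≤ r x → 2 ≤ b x → θ x ≤ x ∧ 2 ≤ r (θ x) ∧ b x ≤ b (θ x) + 1)
    (π : SlotL (USrc (serR r r') (serB b b')) (serB b b') → ℕ)
    (hπ : ∀ q, r q.1.1.1.1 = 0 → π q < b q.1.1.1.1)
    (hπinj : ∀ q q', r q.1.1.1.1 = 0 → q.1.1.1 = q'.1.1.1 → π q = π q' → q = q')
    (ψ : X × Y → X × Y)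
    (hψ : ∀ p p', 1 ≤ r p.1 → b p.1 = 1 → r' p.2 = 0 → 1 ≤ r p'.1 → b p'.1 = 1 → r' p'.2 = 0 →
      ψ p = ψ p' → p = p')
    (hψs : ∀ p, 1 ≤ r p.1 → b p.1 = 1 → r' p.2 = 0 → 1 ≤ b' p.2 →
      ψ p ≤ p ∧ serR r r' (ψ p) = 1)
    (hψI : ∀ p, 1 ≤ r p.1 → b p.1 = 1 → r' p.2 = 0 → 1 ≤ b' p.2 →
      ∀ q (hx : r q.1.1.1.1 = 0), ψ p ≠ (f (serSlotXAt r b r' b' q hx (π q) (hπ q hx)), σ q.1.1.1.2))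
    (hψII : ∀ p, 1 ≤ r p.1 → b p.1 = 1 → r' p.2 = 0 → 1 ≤ b' p.2 →
      ∀ q (hz : r' q.1.1.1.2 = 0), 1 ≤ r q.1.1.1.1 → 2 ≤ b q.1.1.1.1 →
        ψ p ≠ (θ q.1.1.1.1, g (serSlotY r b r' b' q hz))) :
    Universal (serR r r') (serB b b') := by
  refine ⟨serAssignPi r b r' b' f g σ θ ψ π hπ, ?_, ?_⟩
  · -- injectivity
    intro q q' hqq'
    have hsrc := q.1.1.2.1
    have hsrc' := q'.1.1.2.1
    have hblue := ser_src_blue r b r' b' hsrc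
    have hblue' := ser_src_blue r b r' b' hsrc'
    have hred := ser_src_red r b r' b' hsrc
    have hred' := ser_src_red r b r' b' hsrc'
    have hi := q.2
    have hi' := q'.2
    simp only [serB] at hi hi'
    unfold serAssignPi at hqq'
    by_cases hx : r q.1.1.1.1 = 0 <;> by_cases hx' : r q'.1.1.1.1 = 0
    · -- (I) vs (I)
      rw [dif_pos hx, dif_pos hx'] at hqq'
      have h1 : f (serSlotXAt r b r' b' q hx (π q) (hπ q hx)) =
          f (serSlotXAt r b r' b' q' hx' (π q') (hπ q' hx')) := (Prod.mk.inj hqq').1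
      have h2 : σ q.1.1.1.2 = σ q'.1.1.1.2 := (Prod.mk.inj hqq').2
      have h3 := hf h1
      have hxx : q.1.1.1.1 = q'.1.1.1.1 :=
        congrArg (fun s : SlotL (USrc r b) b => s.1.1.1) h3
      have hpi : π q = π q' :=
        congrArg (fun s : SlotL (USrc r b) b => s.1.2.val) h3
      have hzz : q.1.1.1.2 = q'.1.1.1.2 := hσ _ _ hblue.2 hblue'.2 h2
      exact hπinj q q' hx (Prod.ext hxx hzz) hpi
    · -- (I) vs (II)
      exfalso
      rw [dif_pos hx, dif_neg hx'] at hqq'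
      have hz' : r' q'.1.1.1.2 = 0 := by
        rcases hred' with h | h
        · exact absurd h hx'
        · exact h
      by_cases hb' : 2 ≤ b q'.1.1.1.1
      · rw [dif_pos hb'] at hqq'
        have h1 : f (serSlotXAt r b r' b' q hx (π q) (hπ q hx)) = θ q'.1.1.1.1 := (Prod.mk.inj hqq').1
        have hr1 := (hfs (serSlotXAt r b r' b' q hx (π q) (hπ q hx))).2.1
        have hr2 := (hθs q'.1.1.1.1 (by omega) hb').2.1
        rw [h1] at hr1; omega
      · rw [dif_neg hb'] at hqq'
        exact hψI q'.1.1.1 (by omega) (by omega) hz' hblue'.2 q hx hqq'.symm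
    · -- (II) vs (I)
      exfalso
      rw [dif_neg hx, dif_pos hx'] at hqq'
      have hz : r' q.1.1.1.2 = 0 := by
        rcases hred with h | h
        · exact absurd h hx
        · exact h
      by_cases hb : 2 ≤ b q.1.1.1.1
      · rw [dif_pos hb] at hqq'
        have h1 : θ q.1.1.1.1 = f (serSlotXAt r b r' b' q' hx' (π q') (hπ q' hx')) := (Prod.mk.inj hqq').1
        have hr1 := (hfs (serSlotXAt r b r' b' q' hx' (π q') (hπ q' hx'))).2.1
        have hr2 := (hθs q.1.1.1.1 (by omega) hb).2.1
        rw [← h1] at hr1; omega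
      · rw [dif_neg hb] at hqq'
        exact hψI q.1.1.1 (by omega) (by omega) hz hblue.2 q' hx' hqq'
    · -- (II) vs (II)
      rw [dif_neg hx, dif_neg hx'] at hqq'
      have hz : r' q.1.1.1.2 = 0 := by
        rcases hred with h | h
        · exact absurd h hx
        · exact h
      have hz' : r' q'.1.1.1.2 = 0 := by
        rcases hred' with h | h
        · exact absurd h hx'
        · exact h
      by_cases hb : 2 ≤ b q.1.1.1.1 <;> by_cases hb' : 2 ≤ b q'.1.1.1.1
      · -- (II-Q) vs (II-Q)
        rw [dif_pos hb, dif_pos hb'] at hqq'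
        have h1 : θ q.1.1.1.1 = θ q'.1.1.1.1 := (Prod.mk.inj hqq').1
        have h2 : g (serSlotY r b r' b' q hz) = g (serSlotY r b r' b' q' hz') := (Prod.mk.inj hqq').2
        have hxx : q.1.1.1.1 = q'.1.1.1.1 := hθ _ _ (by omega) hb (by omega) hb' h1
        have h3 := hg h2
        have hzz : q.1.1.1.2 = q'.1.1.1.2 :=
          congrArg (fun s : SlotL (USrc r' b') b' => s.1.1.1) h3
        have hidx : q.1.2.val = q'.1.2.val :=
          congrArg (fun s : SlotL (USrc r' b') b' => s.1.2.val) h3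
        exact ser_slot_ext q q' (Prod.ext hxx hzz) hidx
      · -- (II-Q) vs (II-P)
        exfalso
        rw [dif_pos hb, dif_neg hb'] at hqq'
        exact hψII q'.1.1.1 (by omega) (by omega) hz' hblue'.2 q hz (by omega) hb hqq'.symm
      · -- (II-P) vs (II-Q)
        exfalso
        rw [dif_neg hb, dif_pos hb'] at hqq'
        exact hψII q.1.1.1 (by omega) (by omega) hz hblue.2 q' hz' (by omega) hb' hqq'
      · -- (II-P) vs (II-P)
        rw [dif_neg hb, dif_neg hb'] at hqq'
        have hpp : q.1.1.1 = q'.1.1.1 :=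
          hψ _ _ (by omega) (by omega) hz (by omega) (by omega) hz' hqq'
        have hidx : q.1.2.val = q'.1.2.val := by
          have e1 : q.1.1.1.1 = q'.1.1.1.1 := congrArg Prod.fst hpp
          rw [e1] at hi; omega
        exact ser_slot_ext q q' hpp hidx
  · -- the targets
    intro q
    have hsrc := q.1.1.2.1
    have hblue := ser_src_blue r b r' b' hsrc
    have hred := ser_src_red r b r' b' hsrc
    have hi := q.2
    simp only [serB] at hi
    unfold serAssignPi
    by_cases hx : r q.1.1.1.1 = 0
    · rw [dif_pos hx]
      obtain ⟨hle, hr, hb⟩ := hfs (serSlotXAt r b r' b' q hx (π q) (hπ q hx))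
      obtain ⟨hle', hr', hb'⟩ := hσs q.1.1.1.2 hblue.2
      refine ⟨Prod.mk_le_mk.2 ⟨hle, hle'⟩, ?_, ?_⟩
      · simp only [serR]; omega
      · simp only [serB, serSlotXAt_src] at hb ⊢; omega
    · rw [dif_neg hx]
      have hz : r' q.1.1.1.2 = 0 := by
        rcases hred with h | h
        · exact absurd h hx
        · exact h
      by_cases hb : 2 ≤ b q.1.1.1.1
      · rw [dif_pos hb]
        obtain ⟨hle, hr, hbb⟩ := hθs q.1.1.1.1 (by omega) hb
        obtain ⟨hle', hr', hb'⟩ := hgs (serSlotY r b r' b' q hz)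
        refine ⟨Prod.mk_le_mk.2 ⟨hle, hle'⟩, ?_, ?_⟩
        · simp only [serR]; omega
        · simp only [serB, serSlotY_src] at hb' ⊢; omega
      · rw [dif_neg hb]
        obtain ⟨hle, hr⟩ := hψs q.1.1.1 (by omega) (by omega) hz hblue.2
        refine ⟨hle, hr, ?_⟩
        simp only [serB]; omega

end Summit.Ventures.PercRepro2.UHClosure
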